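import Literature.Analysis.FluidPDE.CompressibleEulerImplosionSonicSeriesGrowth
import Literature.Analysis.FluidPDE.CompressibleEulerImplosionSonicMajorantWindow2
import HarnessLib

/-!
# Buckmaster–Cao-Labora–Gómez-Serrano at `γ = 5/3`: the growth lemma of the sonic series on the window `r ∈ [13890041/12500000, 697/625]`

Sequel of `…SonicSeriesGrowth` (generic pieces) and `…SonicMajorantWindow2` (the kernel majorant `MAJAW2`, `MAJBW2` of
`|w_j|2^64/10^j`, `|z_j|2^64/10^j`, `j ≤ 200`). Strong induction on the sharp steps `abs_w_succ_succ_sharp`,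
`abs_z_succ_succ_sharp` with the weights `A_j = (j ≤ 60 ? MAJAW2[j]/2^64 : Θ_a/j³)`, `B_j = (… : Θ_b/j³)`, `Θ_a = 1/800`,
`Θ_b = 7/20` (scaled units `10^j`): the steps at order `N + 2 ≥ 201` reduce, by the piece bounds of the generic file, to TWO
exact rational inequalities checked by the kernel (`budgetW_ok`: `0.00076 ≤ 0.00204`; `budgetZ_ok`: `0.118 ≤ 0.139`), and the
choice of `Θ_a, Θ_b` against the kernel majorant on `60 < j ≤ 200` is `thetaChkW2_ok`. Results, for every `r` in the window:

* `abs_wz_le_weight` : `|w_j(r)| ≤ A_j 10^j` and `|z_j(r)| ≤ B_j 10^j` for every `j`;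
* `abs_wz_le_tail`   : `60 < j → |w_j(r)| ≤ (1/800)10^j/j³ ∧ |z_j(r)| ≤ (7/20)10^j/j³`;
* `abs_w_add_abs_z_le`: `1 ≤ j → |w_j(r)| + |z_j(r)| ≤ 10^j / 2` (the majorant `10^m` of clause (e) of the cavity tube);
* `abs_wz_le_three_pow`: `|w_j(r)| ≤ 3·10^j ∧ |z_j(r)| ≤ 3·10^j` for every `j` (geometric form for the analytic package).

No facts, no axioms. [cite: BuckmasterCaolaboraGomezserrano2025, Prop. 2.3, eqs. (2.9)–(2.10), App. B]
-/

noncomputable section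

open Finset

namespace Literature.Analysis.FluidPDE

namespace BuckmasterCaolaboraGomezserrano2025

namespace Monatomic

namespace SonicSeries

namespace SW2

open Growth
open OriginSeries.CentreW2 (sumQ sumQ_eq sumQ_cast)

set_option linter.style.longLine false
set_option linter.style.setOption false
set_option maxRecDepth 100000
set_option maxHeartbeats 4000000

/-! ### The data and the constants (exact rationals) -/

/-- `Θ_a = 1/800`. [folklore] -/
def thaQ : ℚ := 1 / 800
/-- `Θ_b = 7/20`. [folklore] -/
def thbQ : ℚ := 7 / 20
/-- Head data `A_j = MAJAW2[j]/2^64` (all `j ≤ 200`). [folklore] -/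
def hAQ (j : ℕ) : ℚ := (getN MAJAW2 j : ℚ) / 2 ^ 64
/-- Head data `B_j = MAJBW2[j]/2^64` (all `j ≤ 200`). [folklore] -/
def hBQ (j : ℕ) : ℚ := (getN MAJBW2 j : ℚ) / 2 ^ 64
/-- Data of the weight of `|D_{W,j}|/10^j`: `(2A_j + B_j)/3`. [folklore] -/
def dwdQ (j : ℕ) : ℚ := (2 * hAQ j + hBQ j) / 3
/-- Data of the weight of `|D_{Z,j}|/10^j`: `(A_j + 2B_j)/3`. [folklore] -/
def dzdQ (j : ℕ) : ℚ := (hAQ j + 2 * hBQ j) / 3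
/-- Tail constant of the `D_W` weight. [folklore] -/
def dwTQ : ℚ := (2 * thaQ + thbQ) / 3
/-- Tail constant of the `D_Z` weight. [folklore] -/
def dzTQ : ℚ := (thaQ + 2 * thbQ) / 3
/-- The tail×tail constant of the derivative shape. [folklore] -/
def CsqQ : ℚ := 2 / 61 / 60 + 1 / (60 * 61)
/-- The tail×tail constant of the product shape. [folklore] -/
def CcubeQ : ℚ := (201 / 200) ^ 2 * (4 / 61 / (2 * 60 * 61))

/-- Head functional of the product shape. [folklore] -/
def QHQ (e : ℚ) (dq : ℕ → ℚ) : ℚ := sumQ (fun k => dq (k + 1) * (201 ^ 2 / (199 + e - k) ^ 3)) 60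
/-- Tail×head functional of the product shape. [folklore] -/
def QTQ (e : ℚ) (dq : ℕ → ℚ) : ℚ := sumQ (fun l => dq l * (201 ^ 2 / (200 + e - l) ^ 3)) 61 - dq 0 * (201 ^ 2 / (200 + e) ^ 3)

/-- **The `W`-budget** (absolute, in units `10^{N+2}/(N+2)²`). [folklore] -/
def BWQ : ℚ :=
  thaQ * sumQ (fun k => dwdQ (k + 1) * (201 / (200 - k)) ^ 2) 60
  + dwTQ * sumQ (fun i => i * hAQ i * (201 ^ 2 / (201 - i) ^ 3)) 61 + dwTQ * thaQ * CsqQ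
  + 1 / 10 * (nwwW2 * thaQ + nwzW2 * thbQ) * (201 ^ 2 / 200 ^ 3)
  + 1 / 10 * (5 / 6 * (thaQ * QHQ 0 hAQ + thaQ * QTQ 0 hAQ + thaQ * thaQ * CcubeQ)
    + 1 / 3 * (thbQ * QHQ 0 hAQ + thaQ * QTQ 0 hBQ + thaQ * thbQ * CcubeQ)
    + 1 / 6 * (thbQ * QHQ 0 hBQ + thbQ * QTQ 0 hBQ + thbQ * thbQ * CcubeQ))

/-- **The `Z`-budget** (absolute, in units `10^{N+2}/(N+2)²`). [folklore] -/
def BZQ : ℚ :=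
  cwW2 * thaQ / 201
  + 10 * (thbQ * sumQ (fun k => if k = 0 then 0 else dzdQ (k + 1) * (201 / (200 - k)) ^ 2) 60
    + dzTQ * sumQ (fun i => i * hBQ i * (201 ^ 2 / (201 - i) ^ 3)) 61 + dzTQ * thbQ * CsqQ)
  + 1 / 3 * (thbQ * QHQ 1 hAQ + thaQ * QTQ 1 hBQ + thaQ * thbQ * CcubeQ)
  + 5 / 6 * (thbQ * QHQ 1 hBQ + thbQ * QTQ 1 hBQ + thbQ * thbQ * CcubeQ)
  + 1 / 6 * (thaQ * QHQ 1 hAQ + thaQ * QTQ 1 hAQ + thaQ * thaQ * CcubeQ)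

/-- **The `W`-budget closes**: `BWQ ≤ dloW2 · Θ_a` (`0.00076 ≤ 0.00204`). [folklore] -/
theorem budgetW_ok : BWQ ≤ dloW2 * thaQ := by decide +kernel

/-- **The `Z`-budget closes**: `201·BZQ ≤ Θ_b · dz1W2 · (201 − kkW2)` (`0.118 ≤ 0.139`). [folklore] -/
theorem budgetZ_ok : BZQ * 201 ≤ thbQ * dz1W2 * (201 - kkW2) := by decide +kernel

/-- `Θ_a, Θ_b` dominate the kernel majorant on `60 < j ≤ 200`. [folklore] -/
def thetaChkW2 : ℕ → Bool
  | 0 => true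
  | i + 1 => thetaChkW2 i && decide (hAQ (61 + i) * ((61 + i : ℕ) : ℚ) ^ 3 ≤ thaQ) &&
      decide (hBQ (61 + i) * ((61 + i : ℕ) : ℚ) ^ 3 ≤ thbQ)

/-- [folklore] -/
theorem thetaChkW2_ok : thetaChkW2 140 = true := by decide +kernel

/-- [folklore] -/
theorem of_thetaChkW2 : ∀ m, thetaChkW2 m = true → ∀ i, i < m →
    hAQ (61 + i) * ((61 + i : ℕ) : ℚ) ^ 3 ≤ thaQ ∧ hBQ (61 + i) * ((61 + i : ℕ) : ℚ) ^ 3 ≤ thbQ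
  | 0, _, i, hi => absurd hi (Nat.not_lt_zero _)
  | m + 1, h, i, hi => by
      simp only [thetaChkW2, Bool.and_eq_true, decide_eq_true_eq, and_assoc] at h
      obtain ⟨h0, hA, hB⟩ := h
      rcases Nat.lt_succ_iff_lt_or_eq.mp hi with hlt | rfl
      · exact of_thetaChkW2 m h0 i hlt
      · exact ⟨hA, hB⟩

/-- The head sums of clause (e): `A_j + B_j ≤ 1/2` for `1 ≤ j ≤ 60`, and `A_j, B_j ≤ 3` for `j ≤ 60`. [folklore] -/
def headSumChkW2 : ℕ → Bool
  | 0 => true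
  | i + 1 => headSumChkW2 i && decide (hAQ (i + 1) + hBQ (i + 1) ≤ 1 / 2) && decide (hAQ i ≤ 3) && decide (hBQ i ≤ 3)

/-- [folklore] -/
theorem headSumChkW2_ok : headSumChkW2 61 = true := by decide +kernel

/-- [folklore] -/
theorem of_headSumChkW2 : ∀ m, headSumChkW2 m = true → ∀ i, i < m →
    hAQ (i + 1) + hBQ (i + 1) ≤ 1 / 2 ∧ hAQ i ≤ 3 ∧ hBQ i ≤ 3
  | 0, _, i, hi => absurd hi (Nat.not_lt_zero _)
  | m + 1, h, i, hi => by
      simp only [headSumChkW2, Bool.and_eq_true, decide_eq_true_eq, and_assoc] at h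
      obtain ⟨h0, h1, h2, h3⟩ := h
      rcases Nat.lt_succ_iff_lt_or_eq.mp hi with hlt | rfl
      · exact of_headSumChkW2 m h0 i hlt
      · exact ⟨h1, h2, h3⟩

/-! ### The weights (real side) -/

/-- Head data `A_j` as a real. [folklore] -/
def hAr (j : ℕ) : ℝ := ((hAQ j : ℚ) : ℝ)
/-- Head data `B_j` as a real. [folklore] -/
def hBr (j : ℕ) : ℝ := ((hBQ j : ℚ) : ℝ)
/-- The weight `A_j` of `|w_j|/10^j`. [folklore] -/
def Aw (j : ℕ) : ℝ := wt hAr (1 / 800) j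
/-- The weight `B_j` of `|z_j|/10^j`. [folklore] -/
def Bz (j : ℕ) : ℝ := wt hBr (7 / 20) j

/-- [folklore] -/
theorem hAr_nonneg (j : ℕ) : 0 ≤ hAr j := by unfold hAr hAQ; positivity
/-- [folklore] -/
theorem hBr_nonneg (j : ℕ) : 0 ≤ hBr j := by unfold hBr hBQ; positivity
/-- [folklore] -/
theorem Aw_nonneg (j : ℕ) : 0 ≤ Aw j := wt_nonneg (fun j _ => hAr_nonneg j) (by norm_num) j
/-- [folklore] -/
theorem Bz_nonneg (j : ℕ) : 0 ≤ Bz j := wt_nonneg (fun j _ => hBr_nonneg j) (by norm_num) j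

/-- `hAr j · 10^j = MAJAW2[j] · 10^j/2^64`. [folklore] -/
theorem hAr_mul (j : ℕ) : hAr j * (10 : ℝ) ^ j = (getN MAJAW2 j : ℝ) * ((10 : ℝ) ^ j / (2 : ℝ) ^ 64) := by
  unfold hAr hAQ; push_cast; ring
/-- [folklore] -/
theorem hBr_mul (j : ℕ) : hBr j * (10 : ℝ) ^ j = (getN MAJBW2 j : ℝ) * ((10 : ℝ) ^ j / (2 : ℝ) ^ 64) := by
  unfold hBr hBQ; push_cast; ring

variable {r : ℝ}

/-- **The base of the induction**: the weights bound `|w_j|/10^j`, `|z_j|/10^j` for `j ≤ 200`. [cite: BuckmasterCaolaboraGomezserrano2025, Prop. 2.3, App. B] -/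
theorem abs_wz_le_weight_base (hr : r ∈ Set.Icc ((13890041/12500000 : ℚ) : ℝ) ((697/625 : ℚ) : ℝ)) {j : ℕ} (hj : j ≤ 200) :
    |w r j| ≤ Aw j * (10 : ℝ) ^ j ∧ |z r j| ≤ Bz j * (10 : ℝ) ^ j := by
  obtain ⟨hw, hz⟩ := abs_wz_le_MAJW2 hr hj
  rw [← hAr_mul] at hw
  rw [← hBr_mul] at hz
  rcases le_or_gt j 60 with hle | hlt
  · unfold Aw Bz; rw [wt_of_le hle, wt_of_le hle]; exact ⟨hw, hz⟩
  · obtain ⟨i, rfl⟩ : ∃ i, j = 61 + i := ⟨j - 61, by omega⟩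
    obtain ⟨h1, h2⟩ := of_thetaChkW2 140 thetaChkW2_ok i (by omega)
    have h1' := (Rat.cast_le (K := ℝ)).mpr h1
    have h2' := (Rat.cast_le (K := ℝ)).mpr h2
    push_cast at h1' h2'
    have hj0 : (0 : ℝ) < ((61 + i : ℕ) : ℝ) ^ 3 := by positivity
    unfold Aw Bz; rw [wt_of_lt hlt, wt_of_lt hlt]
    unfold thaQ at h1'; unfold thbQ at h2'
    constructor
    · refine hw.trans (mul_le_mul_of_nonneg_right ?_ (by positivity))
      rw [le_div_iff₀ hj0]; unfold hAr; push_cast at h1' ⊢; linarith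
    · refine hz.trans (mul_le_mul_of_nonneg_right ?_ (by positivity))
      rw [le_div_iff₀ hj0]; unfold hBr; push_cast at h2' ⊢; linarith

/-! ### The derivative shape with the first term removed -/

/-- `Σ_{1 ≤ k ≤ N} TL(N, k) ≤ (Θ₂·H′ + Θ₁·T + Θ₁Θ₂·C_sq)/(N+2)²` with `H′ = Σ_{1≤k<60} d₁(k+1)(201/(200−k))²` (the term
`k = 0` carries the unknown of the `Z`-step and is excluded). [folklore] -/
theorem sum_TL_Ico_le {d₁ d₂ : ℕ → ℝ} {Θ₁ Θ₂ : ℝ} {N : ℕ} (hN : 199 ≤ N) (hd₁ : ∀ j, j ≤ 60 → 0 ≤ d₁ j)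
    (hd₂ : ∀ j, j ≤ 60 → 0 ≤ d₂ j) (hΘ₁ : 0 ≤ Θ₁) (hΘ₂ : 0 ≤ Θ₂) :
    ∑ k ∈ Ico 1 (N + 1), TL d₁ Θ₁ d₂ Θ₂ N k ≤
      (Θ₂ * (∑ k ∈ range 60, if k = 0 then (0 : ℝ) else d₁ (k + 1) * (201 / (200 - (k : ℝ))) ^ 2)
        + Θ₁ * (∑ i ∈ range 61, (i : ℝ) * d₂ i * (201 ^ 2 / (201 - (i : ℝ)) ^ 3))
        + Θ₁ * Θ₂ * (2 / 61 / 60 + 1 / (60 * 61))) / ((N : ℝ) + 2) ^ 2 := by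
  have hsplit : ∑ k ∈ Ico 1 (N + 1), TL d₁ Θ₁ d₂ Θ₂ N k
      = ∑ k ∈ Ico 1 60, TL d₁ Θ₁ d₂ Θ₂ N k + ∑ k ∈ Ico 60 (N - 59), TL d₁ Θ₁ d₂ Θ₂ N k
        + ∑ k ∈ Ico (N - 59) (N + 1), TL d₁ Θ₁ d₂ Θ₂ N k := by
    rw [← sum_Ico_consecutive _ (show 1 ≤ 60 by norm_num) (show 60 ≤ N + 1 by omega),
      ← sum_Ico_consecutive _ (show 60 ≤ N - 59 by omega) (show N - 59 ≤ N + 1 by omega)]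
    ring
  have h1 : ∑ k ∈ Ico 1 60, TL d₁ Θ₁ d₂ Θ₂ N k ≤
      Θ₂ / ((N : ℝ) + 2) ^ 2 * ∑ k ∈ range 60, (if k = 0 then (0 : ℝ) else d₁ (k + 1) * (201 / (200 - (k : ℝ))) ^ 2) := by
    rw [← sum_range_add_sum_Ico _ (show 1 ≤ 60 by norm_num), sum_range_one, if_pos rfl, zero_add, mul_sum]
    refine sum_le_sum fun k hk => ?_
    rw [Finset.mem_Ico] at hk
    rw [if_neg (by omega)]
    exact TL_head hN hk.2 (hd₁ _ (by omega)) hΘ₂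
  have h2 := TL_mid (d₁ := d₁) (d₂ := d₂) hN hΘ₁ hΘ₂
  have h3 : ∑ k ∈ Ico (N - 59) (N + 1), TL d₁ Θ₁ d₂ Θ₂ N k ≤ Θ₁ / ((N : ℝ) + 2) ^ 2 *
      ∑ k ∈ Ico (N - 59) (N + 1), (((N - k + 1 : ℕ) : ℝ)) * d₂ (N - k + 1) * (201 ^ 2 / (201 - ((N - k + 1 : ℕ) : ℝ)) ^ 3) := by
    rw [mul_sum]
    refine sum_le_sum fun k hk => ?_
    rw [Finset.mem_Ico] at hk
    exact TL_tailhead hN hk.1 (by omega) (hd₂ _ (by omega)) hΘ₁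
  have hrefl : ∑ k ∈ Ico (N - 59) (N + 1), (((N - k + 1 : ℕ) : ℝ)) * d₂ (N - k + 1) * (201 ^ 2 / (201 - ((N - k + 1 : ℕ) : ℝ)) ^ 3)
      = ∑ i ∈ range 61, (i : ℝ) * d₂ i * (201 ^ 2 / (201 - (i : ℝ)) ^ 3) := by
    have h := sum_Ico_reflect (fun i : ℕ => (i : ℝ) * d₂ i * (201 ^ 2 / (201 - (i : ℝ)) ^ 3)) (N - 59)
      (m := N + 1) (n := N + 1) (by omega)
    have e1 : N + 1 + 1 - (N + 1) = 1 := by omega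
    have e2 : N + 1 + 1 - (N - 59) = 61 := by omega
    rw [e1, e2] at h
    have e3 : ∑ k ∈ Ico (N - 59) (N + 1), (((N - k + 1 : ℕ) : ℝ)) * d₂ (N - k + 1) * (201 ^ 2 / (201 - ((N - k + 1 : ℕ) : ℝ)) ^ 3)
        = ∑ k ∈ Ico (N - 59) (N + 1), (fun i : ℕ => (i : ℝ) * d₂ i * (201 ^ 2 / (201 - (i : ℝ)) ^ 3)) (N + 1 - k) := by
      refine sum_congr rfl fun k hk => ?_
      rw [Finset.mem_Ico] at hk
      simp only [show N + 1 - k = N - k + 1 by omega]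
    rw [e3, h, ← sum_range_add_sum_Ico _ (show 1 ≤ 61 by norm_num)]
    simp
  rw [hrefl] at h3
  rw [hsplit]
  have := add_le_add (add_le_add h1 h2) h3
  refine this.trans (le_of_eq ?_)
  field_simp
  ring

/-! ### The functionals on the real side and their casts -/

/-- Real data of the `D_W` weight. [folklore] -/
def dwd (j : ℕ) : ℝ := (2 * hAr j + hBr j) / 3
/-- Real data of the `D_Z` weight. [folklore] -/
def dzd (j : ℕ) : ℝ := (hAr j + 2 * hBr j) / 3
/-- [folklore] -/
theorem dwd_nonneg (j : ℕ) : 0 ≤ dwd j := by unfold dwd; have := hAr_nonneg j; have := hBr_nonneg j; positivity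
/-- [folklore] -/
theorem dzd_nonneg (j : ℕ) : 0 ≤ dzd j := by unfold dzd; have := hAr_nonneg j; have := hBr_nonneg j; positivity

/-- Head functional of the `W` derivative convolution. [folklore] -/
def HWr : ℝ := ∑ k ∈ range 60, dwd (k + 1) * (201 / (200 - (k : ℝ))) ^ 2
/-- Head functional of the `Z` derivative convolution (term `k = 0` excluded). [folklore] -/
def HZr : ℝ := ∑ k ∈ range 60, if k = 0 then (0 : ℝ) else dzd (k + 1) * (201 / (200 - (k : ℝ))) ^ 2
/-- Tail×head functional of the derivative shape. [folklore] -/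
def TLr (d : ℕ → ℝ) : ℝ := ∑ i ∈ range 61, (i : ℝ) * d i * (201 ^ 2 / (201 - (i : ℝ)) ^ 3)
/-- Head functional of the product shape. [folklore] -/
def QHr (e : ℕ) (d : ℕ → ℝ) : ℝ := ∑ k ∈ range 60, d (k + 1) * (201 ^ 2 / (199 + (e : ℝ) - k) ^ 3)
/-- Tail×head functional of the product shape. [folklore] -/
def QTr (e : ℕ) (d : ℕ → ℝ) : ℝ := ∑ l ∈ range 61, d l * (201 ^ 2 / (200 + (e : ℝ) - l) ^ 3) - d 0 * (201 ^ 2 / (200 + (e : ℝ)) ^ 3)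

/-- The `W`-budget on the real side. [folklore] -/
def BWr : ℝ :=
  1 / 800 * HWr + (2 * (1 / 800) + 7 / 20) / 3 * TLr hAr + (2 * (1 / 800) + 7 / 20) / 3 * (1 / 800) * (2 / 61 / 60 + 1 / (60 * 61))
  + 1 / 10 * (((nwwW2 : ℚ) : ℝ) * (1 / 800) + ((nwzW2 : ℚ) : ℝ) * (7 / 20)) * (201 ^ 2 / 200 ^ 3)
  + 1 / 10 * (5 / 6 * (1 / 800 * QHr 0 hAr + 1 / 800 * QTr 0 hAr + 1 / 800 * (1 / 800) * ((201 / 200) ^ 2 * (4 / 61 / (2 * 60 * 61))))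
    + 1 / 3 * (7 / 20 * QHr 0 hAr + 1 / 800 * QTr 0 hBr + 1 / 800 * (7 / 20) * ((201 / 200) ^ 2 * (4 / 61 / (2 * 60 * 61))))
    + 1 / 6 * (7 / 20 * QHr 0 hBr + 7 / 20 * QTr 0 hBr + 7 / 20 * (7 / 20) * ((201 / 200) ^ 2 * (4 / 61 / (2 * 60 * 61)))))

/-- The `Z`-budget on the real side. [folklore] -/
def BZr : ℝ :=
  ((cwW2 : ℚ) : ℝ) * (1 / 800) / 201
  + 10 * (7 / 20 * HZr + (1 / 800 + 2 * (7 / 20)) / 3 * TLr hBr + (1 / 800 + 2 * (7 / 20)) / 3 * (7 / 20) * (2 / 61 / 60 + 1 / (60 * 61)))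
  + 1 / 3 * (7 / 20 * QHr 1 hAr + 1 / 800 * QTr 1 hBr + 1 / 800 * (7 / 20) * ((201 / 200) ^ 2 * (4 / 61 / (2 * 60 * 61))))
  + 5 / 6 * (7 / 20 * QHr 1 hBr + 7 / 20 * QTr 1 hBr + 7 / 20 * (7 / 20) * ((201 / 200) ^ 2 * (4 / 61 / (2 * 60 * 61))))
  + 1 / 6 * (1 / 800 * QHr 1 hAr + 1 / 800 * QTr 1 hAr + 1 / 800 * (1 / 800) * ((201 / 200) ^ 2 * (4 / 61 / (2 * 60 * 61))))

/-- [folklore] -/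
theorem sumQ_cast_congr {f : ℕ → ℚ} {g : ℕ → ℝ} (h : ∀ k, ((f k : ℚ) : ℝ) = g k) (n : ℕ) :
    ((sumQ f n : ℚ) : ℝ) = ∑ k ∈ range n, g k := by
  rw [sumQ_cast]; exact sum_congr rfl fun k _ => h k

/-- [folklore] -/
theorem BWQ_cast : ((BWQ : ℚ) : ℝ) = BWr := by
  have hA : ∀ j, ((hAQ j : ℚ) : ℝ) = hAr j := fun j => rfl
  have hB : ∀ j, ((hBQ j : ℚ) : ℝ) = hBr j := fun j => rfl
  have hdw : ∀ j, ((dwdQ j : ℚ) : ℝ) = dwd j := fun j => by unfold dwdQ dwd hAr hBr; push_cast; ring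
  have e1 : ((sumQ (fun k => dwdQ (k + 1) * (201 / (200 - k)) ^ 2) 60 : ℚ) : ℝ) = HWr :=
    sumQ_cast_congr (fun k => by push_cast; rw [hdw]) 60
  have e2 : ∀ (dq : ℕ → ℚ) (dr : ℕ → ℝ), (∀ j, ((dq j : ℚ) : ℝ) = dr j) →
      ((sumQ (fun i => i * dq i * (201 ^ 2 / (201 - i) ^ 3)) 61 : ℚ) : ℝ) = TLr dr :=
    fun dq dr h => sumQ_cast_congr (fun k => by push_cast; rw [h]) 61
  have e3 : ∀ (e : ℕ) (dq : ℕ → ℚ) (dr : ℕ → ℝ), (∀ j, ((dq j : ℚ) : ℝ) = dr j) → ((QHQ e dq : ℚ) : ℝ) = QHr e dr :=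
    fun e dq dr h => by unfold QHQ QHr; exact sumQ_cast_congr (fun k => by push_cast; rw [h]) 60
  have e4 : ∀ (e : ℕ) (dq : ℕ → ℚ) (dr : ℕ → ℝ), (∀ j, ((dq j : ℚ) : ℝ) = dr j) → ((QTQ e dq : ℚ) : ℝ) = QTr e dr :=
    fun e dq dr h => by
      unfold QTQ QTr; push_cast; rw [sumQ_cast_congr (g := fun l => dr l * (201 ^ 2 / (200 + (e : ℝ) - l) ^ 3))
        (fun k => by push_cast; rw [h]) 61, h]
  unfold BWQ BWr
  have f3a := e3 0 hAQ hAr hA; have f3b := e3 0 hBQ hBr hB; have f4a := e4 0 hAQ hAr hA; have f4b := e4 0 hBQ hBr hB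
  have f2 := e2 hAQ hAr hA
  push_cast at f3a f3b f4a f4b f2 ⊢
  rw [e1, f2, f3a, f3b, f4a, f4b]
  unfold dwTQ thaQ thbQ CsqQ CcubeQ
  push_cast
  ring

/-- [folklore] -/
theorem BZQ_cast : ((BZQ : ℚ) : ℝ) = BZr := by
  have hA : ∀ j, ((hAQ j : ℚ) : ℝ) = hAr j := fun j => rfl
  have hB : ∀ j, ((hBQ j : ℚ) : ℝ) = hBr j := fun j => rfl
  have hdz : ∀ j, ((dzdQ j : ℚ) : ℝ) = dzd j := fun j => by unfold dzdQ dzd hAr hBr; push_cast; ring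
  have e1 : ((sumQ (fun k => if k = 0 then 0 else dzdQ (k + 1) * (201 / (200 - k)) ^ 2) 60 : ℚ) : ℝ) = HZr := by
    refine sumQ_cast_congr (fun k => ?_) 60
    split_ifs <;> push_cast
    · simp
    · rw [hdz]
  have e2 : ∀ (dq : ℕ → ℚ) (dr : ℕ → ℝ), (∀ j, ((dq j : ℚ) : ℝ) = dr j) →
      ((sumQ (fun i => i * dq i * (201 ^ 2 / (201 - i) ^ 3)) 61 : ℚ) : ℝ) = TLr dr :=
    fun dq dr h => sumQ_cast_congr (fun k => by push_cast; rw [h]) 61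
  have e3 : ∀ (e : ℕ) (dq : ℕ → ℚ) (dr : ℕ → ℝ), (∀ j, ((dq j : ℚ) : ℝ) = dr j) → ((QHQ e dq : ℚ) : ℝ) = QHr e dr :=
    fun e dq dr h => by unfold QHQ QHr; exact sumQ_cast_congr (fun k => by push_cast; rw [h]) 60
  have e4 : ∀ (e : ℕ) (dq : ℕ → ℚ) (dr : ℕ → ℝ), (∀ j, ((dq j : ℚ) : ℝ) = dr j) → ((QTQ e dq : ℚ) : ℝ) = QTr e dr :=
    fun e dq dr h => by
      unfold QTQ QTr; push_cast; rw [sumQ_cast_congr (g := fun l => dr l * (201 ^ 2 / (200 + (e : ℝ) - l) ^ 3))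
        (fun k => by push_cast; rw [h]) 61, h]
  unfold BZQ BZr
  have f3a := e3 1 hAQ hAr hA; have f3b := e3 1 hBQ hBr hB; have f4a := e4 1 hAQ hAr hA; have f4b := e4 1 hBQ hBr hB
  have f2 := e2 hBQ hBr hB
  push_cast at f3a f3b f4a f4b f2 ⊢
  rw [e1, f2, f3a, f3b, f4a, f4b]
  unfold dzTQ thaQ thbQ CsqQ CcubeQ
  push_cast
  ring

/-- The `W`-budget closes, real side. [folklore] -/
theorem BWr_le : BWr ≤ ((dloW2 : ℚ) : ℝ) * (1 / 800) := by
  have h := (Rat.cast_le (K := ℝ)).mpr budgetW_ok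
  rw [Rat.cast_mul, BWQ_cast] at h
  unfold thaQ at h; push_cast at h; exact h

/-- The `Z`-budget closes, real side. [folklore] -/
theorem BZr_le : BZr * 201 ≤ 7 / 20 * ((dz1W2 : ℚ) : ℝ) * (201 - ((kkW2 : ℚ) : ℝ)) := by
  have h := (Rat.cast_le (K := ℝ)).mpr budgetZ_ok
  push_cast at h
  rw [BZQ_cast] at h
  unfold thbQ at h; push_cast at h; exact h

/-! ### The inductive steps -/

/-- `Aw`, `Bz` combine into the `D_W` weight. [folklore] -/
theorem dw_eq (j : ℕ) : (2 * Aw j + Bz j) / 3 = wt dwd ((2 * (1 / 800) + 7 / 20) / 3) j := by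
  unfold Aw Bz dwd wt; split_ifs <;> ring

/-- `Aw`, `Bz` combine into the `D_Z` weight. [folklore] -/
theorem dz_eq (j : ℕ) : (Aw j + 2 * Bz j) / 3 = wt dzd ((1 / 800 + 2 * (7 / 20)) / 3) j := by
  unfold Aw Bz dzd wt; split_ifs <;> ring

/-- `10^{N+1}/(N+1)³ ≤ (201²/200³)·10^{N+2}/(10 (N+2)²)` for `N ≥ 199`. [folklore] -/
theorem prev_ratio {N : ℕ} (hN : 199 ≤ N) :
    (10 : ℝ) ^ (N + 1) / ((N : ℝ) + 1) ^ 3 ≤ (10 : ℝ) ^ (N + 2) / ((N : ℝ) + 2) ^ 2 * (1 / 10 * (201 ^ 2 / 200 ^ 3)) := by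
  have hr := OriginSeries.CentreW2.ratio_cube (n := N + 1) (j := 1) (by omega) (by omega)
  push_cast at hr
  have hN1 : (0 : ℝ) < (N : ℝ) + 1 := by positivity
  have hN2 : (0 : ℝ) < (N : ℝ) + 2 := by positivity
  have key : ((N : ℝ) + 2) ^ 2 * 200 ^ 3 ≤ 201 ^ 2 * ((N : ℝ) + 1) ^ 3 := by nlinarith [hr]
  rw [div_le_iff₀ (by positivity), pow_succ (10 : ℝ) (N + 1)]
  have h10 : (0 : ℝ) ≤ (10 : ℝ) ^ (N + 1) := by positivity
  calc (10 : ℝ) ^ (N + 1) = (10 : ℝ) ^ (N + 1) * ((((N : ℝ) + 2) ^ 2 * 200 ^ 3) / (((N : ℝ) + 2) ^ 2 * 200 ^ 3)) := by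
        rw [div_self (by positivity), mul_one]
    _ ≤ (10 : ℝ) ^ (N + 1) * ((201 ^ 2 * ((N : ℝ) + 1) ^ 3) / (((N : ℝ) + 2) ^ 2 * 200 ^ 3)) := by gcongr
    _ = _ := by field_simp

/-- A product of two enclosed coefficients in the scaled units. [folklore] -/
theorem prod_le_pow {x y cx cy : ℝ} {i j M : ℕ} (hx : |x| ≤ cx * (10 : ℝ) ^ i) (hy : |y| ≤ cy * (10 : ℝ) ^ j)
    (hcx : 0 ≤ cx) (hM : i + j = M) : |x| * |y| ≤ (10 : ℝ) ^ M * (cx * cy) := by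
  calc |x| * |y| ≤ (cx * (10 : ℝ) ^ i) * (cy * (10 : ℝ) ^ j) := mul_le_mul hx hy (abs_nonneg _) (by positivity)
    _ = _ := by rw [← hM, pow_add]; ring

/-- **The `W`-step**: at order `N + 2 ≥ 201`, `|w_{N+2}| ≤ Θ_a 10^{N+2}/(N+2)³`.
[cite: BuckmasterCaolaboraGomezserrano2025, Prop. 2.3, eq. (2.9)] -/
theorem abs_w_stepW2 (hr : r ∈ Set.Icc ((13890041/12500000 : ℚ) : ℝ) ((697/625 : ℚ) : ℝ)) {N : ℕ} (hN : 199 ≤ N)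
    (ih : ∀ j, j ≤ N + 1 → |w r j| ≤ Aw j * (10 : ℝ) ^ j ∧ |z r j| ≤ Bz j * (10 : ℝ) ^ j) :
    |w r (N + 2)| ≤ (1 / 800 : ℝ) / ((N : ℝ) + 2) ^ 3 * (10 : ℝ) ^ (N + 2) := by
  obtain ⟨hr2, hD, hnww, hnwz, -, -, -⟩ := window_constsW2 hr
  have hsharp := abs_w_succ_succ_sharp hr2 N
  set P : ℝ := (10 : ℝ) ^ (N + 2) with hP
  have hP0 : 0 < P := by rw [hP]; positivity
  have hN2 : (0 : ℝ) < (N : ℝ) + 2 := by positivity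
  have htha : (0 : ℝ) ≤ 1 / 800 := by norm_num
  have hthb : (0 : ℝ) ≤ 7 / 20 := by norm_num
  have hdwT : (0 : ℝ) ≤ (2 * (1 / 800) + 7 / 20) / 3 := by norm_num
  have hA : ∀ i, i ≤ N + 1 → |w r i| ≤ wt hAr (1 / 800) i * (10 : ℝ) ^ i := fun i hi => (ih i hi).1
  have hB : ∀ i, i ≤ N + 1 → |z r i| ≤ wt hBr (7 / 20) i * (10 : ℝ) ^ i := fun i hi => (ih i hi).2
  -- (1) the derivative convolution
  have h1 : (∑ k ∈ range (N + 1), |dWc (w r) (z r) (k + 1)| * (((N + 1 - (k + 1) : ℕ) : ℝ) + 1)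
      * |w r (N + 1 - (k + 1) + 1)|) ≤ P * ∑ k ∈ range (N + 1), TL dwd ((2 * (1 / 800) + 7 / 20) / 3) hAr (1 / 800) N k := by
    rw [mul_sum]
    refine sum_le_sum fun k hk => ?_
    rw [Finset.mem_range] at hk
    have e1 : N + 1 - (k + 1) = N - k := by omega
    rw [e1]
    have hd : |dWc (w r) (z r) (k + 1)| ≤ wt dwd ((2 * (1 / 800) + 7 / 20) / 3) (k + 1) * (10 : ℝ) ^ (k + 1) := by
      rw [← dw_eq, dWc_succ, abs_div, abs_of_pos (by norm_num : (0 : ℝ) < 3), div_mul_eq_mul_div]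
      refine div_le_div_of_nonneg_right ((abs_add_le _ _).trans ?_) (by norm_num)
      have hw1 := hA (k + 1) (by omega); have hz1 := hB (k + 1) (by omega)
      rw [abs_mul, abs_two]; unfold Aw Bz; linarith
    have hnn : (0 : ℝ) ≤ ((N - k : ℕ) : ℝ) + 1 := by positivity
    have hw0 := wt_nonneg (d := dwd) (Θ := (2 * (1 / 800) + 7 / 20) / 3) (fun j _ => dwd_nonneg j) hdwT (k + 1)
    have hx : |dWc (w r) (z r) (k + 1) * ((((N - k : ℕ) : ℝ) + 1))| ≤
        (wt dwd ((2 * (1 / 800) + 7 / 20) / 3) (k + 1) * (((N - k : ℕ) : ℝ) + 1)) * (10 : ℝ) ^ (k + 1) := by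
      rw [abs_mul, abs_of_nonneg hnn]; nlinarith [hd]
    have := prod_le_pow hx (hA (N - k + 1) (by omega)) (mul_nonneg hw0 hnn) (show k + 1 + (N - k + 1) = N + 2 by omega)
    rw [abs_mul, abs_of_nonneg hnn, ← hP] at this
    unfold TL
    calc |dWc (w r) (z r) (k + 1)| * (((N - k : ℕ) : ℝ) + 1) * |w r (N - k + 1)| ≤ _ := this
      _ = _ := by ring
  have h1' := sum_TL_le (d₁ := dwd) (d₂ := hAr) (Θ₁ := (2 * (1 / 800) + 7 / 20) / 3) (Θ₂ := 1 / 800) hN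
    (fun j _ => dwd_nonneg j) (fun j _ => hAr_nonneg j) hdwT htha
  have c1 : (∑ k ∈ range (N + 1), |dWc (w r) (z r) (k + 1)| * (((N + 1 - (k + 1) : ℕ) : ℝ) + 1)
      * |w r (N + 1 - (k + 1) + 1)|)
      ≤ P * ((1 / 800 * HWr + (2 * (1 / 800) + 7 / 20) / 3 * TLr hAr
        + (2 * (1 / 800) + 7 / 20) / 3 * (1 / 800) * (2 / 61 / 60 + 1 / (60 * 61))) / ((N : ℝ) + 2) ^ 2) :=
    h1.trans (mul_le_mul_of_nonneg_left h1' hP0.le)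
  -- (2) the previous-order terms
  have c2 : |NW_W r (W0 r) (Z0 r)| * |w r (N + 1)| + |NW_Z (W0 r) (Z0 r)| * |z r (N + 1)|
      ≤ P * ((1 / 10 * (((nwwW2 : ℚ) : ℝ) * (1 / 800) + ((nwzW2 : ℚ) : ℝ) * (7 / 20)) * (201 ^ 2 / 200 ^ 3)) / ((N : ℝ) + 2) ^ 2) := by
    obtain ⟨hw1, hz1⟩ := ih (N + 1) le_rfl
    unfold Aw at hw1; unfold Bz at hz1
    rw [wt_of_lt (show 60 < N + 1 by omega)] at hw1 hz1
    push_cast at hw1 hz1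
    have hpr := prev_ratio hN
    rw [← hP] at hpr
    have hnww0 : (0 : ℝ) ≤ ((nwwW2 : ℚ) : ℝ) := le_trans (abs_nonneg _) hnww
    have hnwz0 : (0 : ℝ) ≤ ((nwzW2 : ℚ) : ℝ) := le_trans (abs_nonneg _) hnwz
    have ew : 1 / 800 / ((N : ℝ) + 1) ^ 3 * (10 : ℝ) ^ (N + 1) = 1 / 800 * ((10 : ℝ) ^ (N + 1) / ((N : ℝ) + 1) ^ 3) := by ring
    have ez : 7 / 20 / ((N : ℝ) + 1) ^ 3 * (10 : ℝ) ^ (N + 1) = 7 / 20 * ((10 : ℝ) ^ (N + 1) / ((N : ℝ) + 1) ^ 3) := by ring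
    rw [ew] at hw1; rw [ez] at hz1
    have a1 := mul_le_mul hnww hw1 (abs_nonneg _) hnww0
    have a2 := mul_le_mul hnwz hz1 (abs_nonneg _) hnwz0
    have b1 := mul_le_mul_of_nonneg_left hpr (mul_nonneg hnww0 htha)
    have b2 := mul_le_mul_of_nonneg_left hpr (mul_nonneg hnwz0 hthb)
    have e : P * ((1 / 10 * (((nwwW2 : ℚ) : ℝ) * (1 / 800) + ((nwzW2 : ℚ) : ℝ) * (7 / 20)) * (201 ^ 2 / 200 ^ 3)) / ((N : ℝ) + 2) ^ 2)
        = ((nwwW2 : ℚ) : ℝ) * (1 / 800) * (P / ((N : ℝ) + 2) ^ 2 * (1 / 10 * (201 ^ 2 / 200 ^ 3)))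
          + ((nwzW2 : ℚ) : ℝ) * (7 / 20) * (P / ((N : ℝ) + 2) ^ 2 * (1 / 10 * (201 ^ 2 / 200 ^ 3))) := by ring
    rw [e]
    linarith
  -- (3) the quadratic terms
  have hq : ∀ {f g : ℕ → ℝ} {df dg : ℕ → ℝ} {tf tg : ℝ}, (∀ i, i ≤ N + 1 → |f i| ≤ wt df tf i * (10 : ℝ) ^ i) →
      (∀ i, i ≤ N + 1 → |g i| ≤ wt dg tg i * (10 : ℝ) ^ i) → (∀ j, j ≤ 60 → 0 ≤ df j) → 0 ≤ tf →
      (∑ k ∈ range N, |f (k + 1)| * |g (N - k)|) ≤ P / 10 * ∑ k ∈ range (N + 0), TQ df tf dg tg N 0 k := by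
    intro f g df dg tf tg hf hg hdf htf
    rw [mul_sum]
    refine sum_le_sum fun k hk => ?_
    rw [Finset.mem_range] at hk
    have hw0 := wt_nonneg hdf htf (k + 1)
    have := prod_le_pow (hf (k + 1) (by omega)) (hg (N - k) (by omega)) hw0 (show k + 1 + (N - k) = N + 1 by omega)
    unfold TQ
    refine this.trans (le_of_eq ?_)
    rw [hP, pow_succ _ (N + 1)]
    ring
  have c3 := (hq hA hA (fun j _ => hAr_nonneg j) htha).trans (mul_le_mul_of_nonneg_left
    (sum_TQ_le (d₁ := hAr) (d₂ := hAr) (Θ₁ := 1 / 800) (Θ₂ := 1 / 800) (e := 0) hN (by norm_num)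
      (fun j _ => hAr_nonneg j) (fun j _ => hAr_nonneg j) htha htha) (by positivity))
  have c4 := (hq hA hB (fun j _ => hAr_nonneg j) htha).trans (mul_le_mul_of_nonneg_left
    (sum_TQ_le (d₁ := hAr) (d₂ := hBr) (Θ₁ := 1 / 800) (Θ₂ := 7 / 20) (e := 0) hN (by norm_num)
      (fun j _ => hAr_nonneg j) (fun j _ => hBr_nonneg j) htha hthb) (by positivity))
  have c5 := (hq hB hB (fun j _ => hBr_nonneg j) hthb).trans (mul_le_mul_of_nonneg_left
    (sum_TQ_le (d₁ := hBr) (d₂ := hBr) (Θ₁ := 7 / 20) (Θ₂ := 7 / 20) (e := 0) hN (by norm_num)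
      (fun j _ => hBr_nonneg j) (fun j _ => hBr_nonneg j) hthb hthb) (by positivity))
  change _ ≤ P / 10 * ((1 / 800 * QHr 0 hAr + 1 / 800 * QTr 0 hAr + 1 / 800 * (1 / 800) * ((201 / 200) ^ 2 * (4 / 61 / (2 * 60 * 61)))) / ((N : ℝ) + 2) ^ 2) at c3
  change _ ≤ P / 10 * ((7 / 20 * QHr 0 hAr + 1 / 800 * QTr 0 hBr + 1 / 800 * (7 / 20) * ((201 / 200) ^ 2 * (4 / 61 / (2 * 60 * 61)))) / ((N : ℝ) + 2) ^ 2) at c4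
  change _ ≤ P / 10 * ((7 / 20 * QHr 0 hBr + 7 / 20 * QTr 0 hBr + 7 / 20 * (7 / 20) * ((201 / 200) ^ 2 * (4 / 61 / (2 * 60 * 61)))) / ((N : ℝ) + 2) ^ 2) at c5
  -- assemble
  have hbud := BWr_le
  have hDpos : (0 : ℝ) < DW (W0 r) (Z0 r) := DW_Ps_pos hr2
  have hmain : |w r (N + 2)| * (DW (W0 r) (Z0 r) * ((N : ℝ) + 2)) ≤ P / ((N : ℝ) + 2) ^ 2 * BWr := by
    refine hsharp.trans ?_
    have e : P / ((N : ℝ) + 2) ^ 2 * BWr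
        = P * ((1 / 800 * HWr + (2 * (1 / 800) + 7 / 20) / 3 * TLr hAr
            + (2 * (1 / 800) + 7 / 20) / 3 * (1 / 800) * (2 / 61 / 60 + 1 / (60 * 61))) / ((N : ℝ) + 2) ^ 2)
          + P * ((1 / 10 * (((nwwW2 : ℚ) : ℝ) * (1 / 800) + ((nwzW2 : ℚ) : ℝ) * (7 / 20)) * (201 ^ 2 / 200 ^ 3)) / ((N : ℝ) + 2) ^ 2)
          + (5 / 6 * (P / 10 * ((1 / 800 * QHr 0 hAr + 1 / 800 * QTr 0 hAr + 1 / 800 * (1 / 800) * ((201 / 200) ^ 2 * (4 / 61 / (2 * 60 * 61)))) / ((N : ℝ) + 2) ^ 2))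
            + 1 / 3 * (P / 10 * ((7 / 20 * QHr 0 hAr + 1 / 800 * QTr 0 hBr + 1 / 800 * (7 / 20) * ((201 / 200) ^ 2 * (4 / 61 / (2 * 60 * 61)))) / ((N : ℝ) + 2) ^ 2))
            + 1 / 6 * (P / 10 * ((7 / 20 * QHr 0 hBr + 7 / 20 * QTr 0 hBr + 7 / 20 * (7 / 20) * ((201 / 200) ^ 2 * (4 / 61 / (2 * 60 * 61)))) / ((N : ℝ) + 2) ^ 2))) := by
      unfold BWr; ring
    rw [e]
    linarith [c1, c2, c3, c4, c5]
  have hden : 0 < DW (W0 r) (Z0 r) * ((N : ℝ) + 2) := mul_pos hDpos hN2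
  have hfin : P / ((N : ℝ) + 2) ^ 2 * BWr ≤ (1 / 800 : ℝ) / ((N : ℝ) + 2) ^ 3 * P * (DW (W0 r) (Z0 r) * ((N : ℝ) + 2)) := by
    have h1 : P / ((N : ℝ) + 2) ^ 2 * BWr ≤ P / ((N : ℝ) + 2) ^ 2 * (((dloW2 : ℚ) : ℝ) * (1 / 800)) :=
      mul_le_mul_of_nonneg_left hbud (by positivity)
    have h2 : ((dloW2 : ℚ) : ℝ) * ((N : ℝ) + 2) ≤ DW (W0 r) (Z0 r) * ((N : ℝ) + 2) := mul_le_mul_of_nonneg_right hD hN2.le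
    calc P / ((N : ℝ) + 2) ^ 2 * BWr ≤ P / ((N : ℝ) + 2) ^ 2 * (((dloW2 : ℚ) : ℝ) * (1 / 800)) := h1
      _ = (1 / 800 : ℝ) / ((N : ℝ) + 2) ^ 3 * P * (((dloW2 : ℚ) : ℝ) * ((N : ℝ) + 2)) := by field_simp
      _ ≤ _ := mul_le_mul_of_nonneg_left h2 (by positivity)
  have := hmain.trans hfin
  rw [show (1 / 800 : ℝ) / ((N : ℝ) + 2) ^ 3 * P * (DW (W0 r) (Z0 r) * ((N : ℝ) + 2))
    = ((1 / 800 : ℝ) / ((N : ℝ) + 2) ^ 3 * P) * (DW (W0 r) (Z0 r) * ((N : ℝ) + 2)) by ring] at this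
  exact le_of_mul_le_mul_right this hden

/-- **The `Z`-step**: at order `N + 2 ≥ 201`, `|z_{N+2}| ≤ Θ_b 10^{N+2}/(N+2)³` (given the `W`-step at the same order).
[cite: BuckmasterCaolaboraGomezserrano2025, Prop. 2.3, eq. (2.10)] -/
theorem abs_z_stepW2 (hr : r ∈ Set.Icc ((13890041/12500000 : ℚ) : ℝ) ((697/625 : ℚ) : ℝ)) {N : ℕ} (hN : 199 ≤ N)
    (ih : ∀ j, j ≤ N + 1 → |w r j| ≤ Aw j * (10 : ℝ) ^ j ∧ |z r j| ≤ Bz j * (10 : ℝ) ^ j)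
    (hwnew : |w r (N + 2)| ≤ (1 / 800 : ℝ) / ((N : ℝ) + 2) ^ 3 * (10 : ℝ) ^ (N + 2)) :
    |z r (N + 2)| ≤ (7 / 20 : ℝ) / ((N : ℝ) + 2) ^ 3 * (10 : ℝ) ^ (N + 2) := by
  obtain ⟨hr2, -, -, -, hcw, hkk, hsl⟩ := window_constsW2 hr
  have hsharp := abs_z_succ_succ_sharp r N
  set P : ℝ := (10 : ℝ) ^ (N + 2) with hP
  have hP0 : 0 < P := by rw [hP]; positivity
  have hNR : (199 : ℝ) ≤ N := by exact_mod_cast hN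
  have hN2 : (0 : ℝ) < (N : ℝ) + 2 := by positivity
  have htha : (0 : ℝ) ≤ 1 / 800 := by norm_num
  have hthb : (0 : ℝ) ≤ 7 / 20 := by norm_num
  have hdzT : (0 : ℝ) ≤ (1 / 800 + 2 * (7 / 20)) / 3 := by norm_num
  have hA : ∀ i, i ≤ N + 1 → |w r i| ≤ wt hAr (1 / 800) i * (10 : ℝ) ^ i := fun i hi => (ih i hi).1
  have hB : ∀ i, i ≤ N + 1 → |z r i| ≤ wt hBr (7 / 20) i * (10 : ℝ) ^ i := fun i hi => (ih i hi).2
  -- (0) the `coefW` term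
  have hcw0 : (0 : ℝ) ≤ ((cwW2 : ℚ) : ℝ) := le_trans (abs_nonneg _) hcw
  have c0 : |coefW (w r) (z r)| * |w r (N + 2)| ≤ P * ((((cwW2 : ℚ) : ℝ) * (1 / 800) / 201) / ((N : ℝ) + 2) ^ 2) := by
    have h1 := mul_le_mul hcw hwnew (abs_nonneg _) hcw0
    refine h1.trans ?_
    rw [hP]
    have hle : 1 / ((N : ℝ) + 2) ≤ 1 / 201 := one_div_le_one_div_of_le (by norm_num) (by linarith)
    have e1 : ((cwW2 : ℚ) : ℝ) * (1 / 800 / ((N : ℝ) + 2) ^ 3 * (10 : ℝ) ^ (N + 2))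
        = (((cwW2 : ℚ) : ℝ) * (1 / 800) * (10 : ℝ) ^ (N + 2) / ((N : ℝ) + 2) ^ 2) * (1 / ((N : ℝ) + 2)) := by
      field_simp
    have e2 : (10 : ℝ) ^ (N + 2) * ((((cwW2 : ℚ) : ℝ) * (1 / 800) / 201) / ((N : ℝ) + 2) ^ 2)
        = (((cwW2 : ℚ) : ℝ) * (1 / 800) * (10 : ℝ) ^ (N + 2) / ((N : ℝ) + 2) ^ 2) * (1 / 201) := by
      field_simp
    rw [e1, e2]
    exact mul_le_mul_of_nonneg_left hle (by positivity)
  -- (1) the derivative convolution, re-indexed to level `N + 1`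
  have c1 : (∑ k ∈ range N, |dZc (w r) (z r) (k + 2)| * (((N - k : ℕ) : ℝ) + 1) * |z r (N - k + 1)|)
      ≤ P * ((10 * (7 / 20 * HZr + (1 / 800 + 2 * (7 / 20)) / 3 * TLr hBr
        + (1 / 800 + 2 * (7 / 20)) / 3 * (7 / 20) * (2 / 61 / 60 + 1 / (60 * 61)))) / ((N : ℝ) + 2) ^ 2) := by
    -- re-index `k' = k + 1`
    have hre : (∑ k ∈ range N, |dZc (w r) (z r) (k + 2)| * (((N - k : ℕ) : ℝ) + 1) * |z r (N - k + 1)|)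
        = ∑ k ∈ Ico 1 (N + 1), |dZc (w r) (z r) (k + 1)| * ((((N + 1) - k : ℕ) : ℝ) + 1) * |z r ((N + 1) - k + 1)| := by
      rw [Finset.sum_Ico_eq_sum_range, show N + 1 - 1 = N by omega]
      refine sum_congr rfl fun k hk => ?_
      rw [show 1 + k + 1 = k + 2 by omega, show N + 1 - (1 + k) = N - k by omega]
    rw [hre]
    -- termwise
    have hterm : ∀ k ∈ Ico 1 (N + 1), |dZc (w r) (z r) (k + 1)| * ((((N + 1) - k : ℕ) : ℝ) + 1) * |z r ((N + 1) - k + 1)|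
        ≤ P * 10 * TL dzd ((1 / 800 + 2 * (7 / 20)) / 3) hBr (7 / 20) (N + 1) k := by
      intro k hk
      rw [Finset.mem_Ico] at hk
      have hd : |dZc (w r) (z r) (k + 1)| ≤ wt dzd ((1 / 800 + 2 * (7 / 20)) / 3) (k + 1) * (10 : ℝ) ^ (k + 1) := by
        rw [← dz_eq, dZc_succ, abs_div, abs_of_pos (by norm_num : (0 : ℝ) < 3), div_mul_eq_mul_div]
        refine div_le_div_of_nonneg_right ((abs_add_le _ _).trans ?_) (by norm_num)
        have hw1 := hA (k + 1) (by omega); have hz1 := hB (k + 1) (by omega)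
        rw [abs_mul, abs_two]; unfold Aw Bz; linarith
      have hnn : (0 : ℝ) ≤ (((N + 1) - k : ℕ) : ℝ) + 1 := by positivity
      have hw0 := wt_nonneg (d := dzd) (Θ := (1 / 800 + 2 * (7 / 20)) / 3) (fun j _ => dzd_nonneg j) hdzT (k + 1)
      have hx : |dZc (w r) (z r) (k + 1) * (((((N + 1) - k : ℕ) : ℝ) + 1))| ≤
          (wt dzd ((1 / 800 + 2 * (7 / 20)) / 3) (k + 1) * ((((N + 1) - k : ℕ) : ℝ) + 1)) * (10 : ℝ) ^ (k + 1) := by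
        rw [abs_mul, abs_of_nonneg hnn]; nlinarith [hd]
      have := prod_le_pow hx (hB ((N + 1) - k + 1) (by omega)) (mul_nonneg hw0 hnn)
        (show k + 1 + ((N + 1) - k + 1) = (N + 2) + 1 by omega)
      rw [abs_mul, abs_of_nonneg hnn, pow_succ, ← hP] at this
      unfold TL
      calc |dZc (w r) (z r) (k + 1)| * ((((N + 1) - k : ℕ) : ℝ) + 1) * |z r ((N + 1) - k + 1)| ≤ _ := this
        _ = _ := by ring
    refine (sum_le_sum hterm).trans ?_
    rw [← mul_sum]
    have hTL0 : ∀ k, 0 ≤ TL dzd ((1 / 800 + 2 * (7 / 20)) / 3) hBr (7 / 20) (N + 1) k := fun k => by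
      unfold TL
      exact mul_nonneg (mul_nonneg (wt_nonneg (fun j _ => dzd_nonneg j) hdzT _) (by positivity))
        (wt_nonneg (fun j _ => hBr_nonneg j) hthb _)
    have hmono : ∑ k ∈ Ico 1 (N + 1), TL dzd ((1 / 800 + 2 * (7 / 20)) / 3) hBr (7 / 20) (N + 1) k
        ≤ ∑ k ∈ Ico 1 (N + 1 + 1), TL dzd ((1 / 800 + 2 * (7 / 20)) / 3) hBr (7 / 20) (N + 1) k :=
      sum_le_sum_of_subset_of_nonneg (Ico_subset_Ico le_rfl (by omega)) fun k _ _ => hTL0 k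
    have hlev := sum_TL_Ico_le (d₁ := dzd) (d₂ := hBr) (Θ₁ := (1 / 800 + 2 * (7 / 20)) / 3) (Θ₂ := 7 / 20)
      (N := N + 1) (by omega) (fun j _ => dzd_nonneg j) (fun j _ => hBr_nonneg j) hdzT hthb
    change _ ≤ (7 / 20 * HZr + (1 / 800 + 2 * (7 / 20)) / 3 * TLr hBr
      + (1 / 800 + 2 * (7 / 20)) / 3 * (7 / 20) * (2 / 61 / 60 + 1 / (60 * 61))) / ((((N + 1 : ℕ)) : ℝ) + 2) ^ 2 at hlev
    have hnum0 : 0 ≤ 7 / 20 * HZr + (1 / 800 + 2 * (7 / 20)) / 3 * TLr hBr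
        + (1 / 800 + 2 * (7 / 20)) / 3 * (7 / 20) * (2 / 61 / 60 + 1 / (60 * 61)) := by
      have h1 : 0 ≤ HZr := by
        unfold HZr; refine sum_nonneg fun k _ => ?_; split_ifs
        · exact le_rfl
        · have := dzd_nonneg (k + 1); positivity
      have h2 : 0 ≤ TLr hBr := by
        unfold TLr; refine sum_nonneg fun i hi => ?_
        rw [Finset.mem_range] at hi
        have : (i : ℝ) < 61 := by exact_mod_cast hi
        have := hBr_nonneg i
        have : (0 : ℝ) < 201 - i := by linarith
        positivity
      positivity
    have hden : (7 / 20 * HZr + (1 / 800 + 2 * (7 / 20)) / 3 * TLr hBr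
        + (1 / 800 + 2 * (7 / 20)) / 3 * (7 / 20) * (2 / 61 / 60 + 1 / (60 * 61))) / ((((N + 1 : ℕ)) : ℝ) + 2) ^ 2
        ≤ (7 / 20 * HZr + (1 / 800 + 2 * (7 / 20)) / 3 * TLr hBr
        + (1 / 800 + 2 * (7 / 20)) / 3 * (7 / 20) * (2 / 61 / 60 + 1 / (60 * 61))) / ((N : ℝ) + 2) ^ 2 := by
      refine div_le_div_of_nonneg_left hnum0 (by positivity) ?_
      push_cast; nlinarith
    have := (hmono.trans hlev).trans hden
    have := mul_le_mul_of_nonneg_left this (show 0 ≤ P * 10 by positivity)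
    refine this.trans (le_of_eq ?_)
    ring
  -- (2) the quadratic terms (`e = 1`)
  have hq : ∀ {f g : ℕ → ℝ} {df dg : ℕ → ℝ} {tf tg : ℝ}, (∀ i, i ≤ N + 1 → |f i| ≤ wt df tf i * (10 : ℝ) ^ i) →
      (∀ i, i ≤ N + 1 → |g i| ≤ wt dg tg i * (10 : ℝ) ^ i) → (∀ j, j ≤ 60 → 0 ≤ df j) → 0 ≤ tf →
      (∑ k ∈ range (N + 1), |f (k + 1)| * |g (N + 1 - k)|) ≤ P * ∑ k ∈ range (N + 1), TQ df tf dg tg N 1 k := by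
    intro f g df dg tf tg hf hg hdf htf
    rw [mul_sum]
    refine sum_le_sum fun k hk => ?_
    rw [Finset.mem_range] at hk
    have hw0 := wt_nonneg hdf htf (k + 1)
    have := prod_le_pow (hf (k + 1) (by omega)) (hg (N + 1 - k) (by omega)) hw0 (show k + 1 + (N + 1 - k) = N + 2 by omega)
    rw [← hP] at this
    unfold TQ
    exact this
  have c3 := (hq hA hB (fun j _ => hAr_nonneg j) htha).trans (mul_le_mul_of_nonneg_left
    (sum_TQ_le (d₁ := hAr) (d₂ := hBr) (Θ₁ := 1 / 800) (Θ₂ := 7 / 20) (e := 1) hN (by norm_num)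
      (fun j _ => hAr_nonneg j) (fun j _ => hBr_nonneg j) htha hthb) hP0.le)
  have c4 := (hq hB hB (fun j _ => hBr_nonneg j) hthb).trans (mul_le_mul_of_nonneg_left
    (sum_TQ_le (d₁ := hBr) (d₂ := hBr) (Θ₁ := 7 / 20) (Θ₂ := 7 / 20) (e := 1) hN (by norm_num)
      (fun j _ => hBr_nonneg j) (fun j _ => hBr_nonneg j) hthb hthb) hP0.le)
  have c5 := (hq hA hA (fun j _ => hAr_nonneg j) htha).trans (mul_le_mul_of_nonneg_left
    (sum_TQ_le (d₁ := hAr) (d₂ := hAr) (Θ₁ := 1 / 800) (Θ₂ := 1 / 800) (e := 1) hN (by norm_num)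
      (fun j _ => hAr_nonneg j) (fun j _ => hAr_nonneg j) htha htha) hP0.le)
  change _ ≤ P * ((7 / 20 * QHr 1 hAr + 1 / 800 * QTr 1 hBr + 1 / 800 * (7 / 20) * ((201 / 200) ^ 2 * (4 / 61 / (2 * 60 * 61)))) / ((N : ℝ) + 2) ^ 2) at c3
  change _ ≤ P * ((7 / 20 * QHr 1 hBr + 7 / 20 * QTr 1 hBr + 7 / 20 * (7 / 20) * ((201 / 200) ^ 2 * (4 / 61 / (2 * 60 * 61)))) / ((N : ℝ) + 2) ^ 2) at c4
  change _ ≤ P * ((1 / 800 * QHr 1 hAr + 1 / 800 * QTr 1 hAr + 1 / 800 * (1 / 800) * ((201 / 200) ^ 2 * (4 / 61 / (2 * 60 * 61)))) / ((N : ℝ) + 2) ^ 2) at c5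
  -- assemble
  have hmain : |z r (N + 2)| * |slopeZ r (w r) (z r) (N + 2)| ≤ P / ((N : ℝ) + 2) ^ 2 * BZr := by
    refine hsharp.trans ?_
    have e : P / ((N : ℝ) + 2) ^ 2 * BZr
        = P * ((((cwW2 : ℚ) : ℝ) * (1 / 800) / 201) / ((N : ℝ) + 2) ^ 2)
          + P * ((10 * (7 / 20 * HZr + (1 / 800 + 2 * (7 / 20)) / 3 * TLr hBr
              + (1 / 800 + 2 * (7 / 20)) / 3 * (7 / 20) * (2 / 61 / 60 + 1 / (60 * 61)))) / ((N : ℝ) + 2) ^ 2)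
          + (1 / 3 * (P * ((7 / 20 * QHr 1 hAr + 1 / 800 * QTr 1 hBr + 1 / 800 * (7 / 20) * ((201 / 200) ^ 2 * (4 / 61 / (2 * 60 * 61)))) / ((N : ℝ) + 2) ^ 2))
            + 5 / 6 * (P * ((7 / 20 * QHr 1 hBr + 7 / 20 * QTr 1 hBr + 7 / 20 * (7 / 20) * ((201 / 200) ^ 2 * (4 / 61 / (2 * 60 * 61)))) / ((N : ℝ) + 2) ^ 2))
            + 1 / 6 * (P * ((1 / 800 * QHr 1 hAr + 1 / 800 * QTr 1 hAr + 1 / 800 * (1 / 800) * ((201 / 200) ^ 2 * (4 / 61 / (2 * 60 * 61)))) / ((N : ℝ) + 2) ^ 2))) := by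
      unfold BZr; ring
    rw [e]
    linarith [c0, c1, c3, c4, c5]
  -- the denominator `|slopeZ(N+2)| ≥ dz1 (N + 2 − kk)` and the budget
  have hslN := hsl (N + 2) (by omega)
  push_cast at hslN
  have hbud := BZr_le
  have hdz1 : (0 : ℝ) < ((dz1W2 : ℚ) : ℝ) := by unfold dz1W2; push_cast; norm_num
  have hkk0 : (0 : ℝ) ≤ ((kkW2 : ℚ) : ℝ) := by unfold kkW2; push_cast; norm_num
  have hden : (0 : ℝ) < ((dz1W2 : ℚ) : ℝ) * ((N : ℝ) + 2 - ((kkW2 : ℚ) : ℝ)) := mul_pos hdz1 (by linarith)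
  have hslpos : 0 < |slopeZ r (w r) (z r) (N + 2)| := lt_of_lt_of_le hden hslN
  have hBZr0 : 0 ≤ BZr := by
    have := mul_nonneg (abs_nonneg (z r (N + 2))) hslpos.le
    have h := this.trans hmain
    have hV : (0 : ℝ) < P / ((N : ℝ) + 2) ^ 2 := by positivity
    nlinarith
  have hbud' : BZr * ((N : ℝ) + 2) ≤ 7 / 20 * (((dz1W2 : ℚ) : ℝ) * ((N : ℝ) + 2 - ((kkW2 : ℚ) : ℝ))) := by
    nlinarith [hbud, mul_nonneg hBZr0 (show (0 : ℝ) ≤ (N : ℝ) + 2 - 201 by linarith),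
      mul_nonneg hkk0 (show (0 : ℝ) ≤ (N : ℝ) + 2 - 201 by linarith), mul_nonneg hdz1.le hkk0]
  have key : P / ((N : ℝ) + 2) ^ 2 * BZr ≤ (7 / 20 : ℝ) / ((N : ℝ) + 2) ^ 3 * P * |slopeZ r (w r) (z r) (N + 2)| := by
    calc P / ((N : ℝ) + 2) ^ 2 * BZr = P / ((N : ℝ) + 2) ^ 3 * (BZr * ((N : ℝ) + 2)) := by field_simp
      _ ≤ P / ((N : ℝ) + 2) ^ 3 * (7 / 20 * (((dz1W2 : ℚ) : ℝ) * ((N : ℝ) + 2 - ((kkW2 : ℚ) : ℝ)))) :=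
          mul_le_mul_of_nonneg_left hbud' (by positivity)
      _ ≤ P / ((N : ℝ) + 2) ^ 3 * (7 / 20 * |slopeZ r (w r) (z r) (N + 2)|) :=
          mul_le_mul_of_nonneg_left (mul_le_mul_of_nonneg_left hslN hthb) (by positivity)
      _ = _ := by ring
  have := hmain.trans key
  rw [show (7 / 20 : ℝ) / ((N : ℝ) + 2) ^ 3 * P * |slopeZ r (w r) (z r) (N + 2)|
    = ((7 / 20 : ℝ) / ((N : ℝ) + 2) ^ 3 * P) * |slopeZ r (w r) (z r) (N + 2)| by ring] at this
  exact le_of_mul_le_mul_right this hslpos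

/-! ### The growth lemma and its consequences -/

/-- **The growth lemma of the sonic series**: `|w_j(r)| ≤ A_j 10^j` and `|z_j(r)| ≤ B_j 10^j` for EVERY `j`, on the
window. [cite: BuckmasterCaolaboraGomezserrano2025, Prop. 2.3, App. B] -/
theorem abs_wz_le_weight (hr : r ∈ Set.Icc ((13890041/12500000 : ℚ) : ℝ) ((697/625 : ℚ) : ℝ)) :
    ∀ j, |w r j| ≤ Aw j * (10 : ℝ) ^ j ∧ |z r j| ≤ Bz j * (10 : ℝ) ^ j := by
  intro j
  induction j using Nat.strong_induction_on with
  | _ j ih =>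
    rcases le_or_gt j 200 with hj | hj
    · exact abs_wz_le_weight_base hr hj
    · obtain ⟨N, rfl⟩ : ∃ N, j = N + 2 := ⟨j - 2, by omega⟩
      have hN : 199 ≤ N := by omega
      have ih' : ∀ i, i ≤ N + 1 → |w r i| ≤ Aw i * (10 : ℝ) ^ i ∧ |z r i| ≤ Bz i * (10 : ℝ) ^ i :=
        fun i hi => ih i (by omega)
      have hw := abs_w_stepW2 hr hN ih'
      have hz := abs_z_stepW2 hr hN ih' hw
      have hcast : (((N + 2 : ℕ)) : ℝ) = (N : ℝ) + 2 := by push_cast; ring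
      unfold Aw Bz
      rw [wt_of_lt (by omega), wt_of_lt (by omega), hcast]
      exact ⟨hw, hz⟩

/-- **The tail of the sonic series**: `|w_j(r)| ≤ (1/800)·10^j/j³` and `|z_j(r)| ≤ (7/20)·10^j/j³` for every `j > 60`,
on the window. [cite: BuckmasterCaolaboraGomezserrano2025, Prop. 2.3, App. B] -/
theorem abs_wz_le_tail (hr : r ∈ Set.Icc ((13890041/12500000 : ℚ) : ℝ) ((697/625 : ℚ) : ℝ)) {j : ℕ} (hj : 60 < j) :
    |w r j| ≤ (1 / 800 : ℝ) / (j : ℝ) ^ 3 * (10 : ℝ) ^ j ∧ |z r j| ≤ (7 / 20 : ℝ) / (j : ℝ) ^ 3 * (10 : ℝ) ^ j := by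
  have h := abs_wz_le_weight hr j
  unfold Aw Bz at h
  rwa [wt_of_lt hj, wt_of_lt hj] at h

/-- **The majorant `10^m/2` of clause (e)**: `|w_j(r)| + |z_j(r)| ≤ 10^j/2` for every `j ≥ 1`, on the window.
[cite: BuckmasterCaolaboraGomezserrano2025, Prop. 2.3, App. B] -/
theorem abs_w_add_abs_z_le (hr : r ∈ Set.Icc ((13890041/12500000 : ℚ) : ℝ) ((697/625 : ℚ) : ℝ)) {j : ℕ} (hj : 1 ≤ j) :
    |w r j| + |z r j| ≤ (10 : ℝ) ^ j / 2 := by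
  obtain ⟨hw, hz⟩ := abs_wz_le_weight hr j
  have hp : (0 : ℝ) < (10 : ℝ) ^ j := by positivity
  rcases le_or_gt j 60 with hle | hlt
  · obtain ⟨i, rfl⟩ : ∃ i, j = i + 1 := ⟨j - 1, by omega⟩
    obtain ⟨h1, -, -⟩ := of_headSumChkW2 61 headSumChkW2_ok i (by omega)
    have h1' := (Rat.cast_le (K := ℝ)).mpr h1
    push_cast at h1'
    unfold Aw at hw; unfold Bz at hz
    rw [wt_of_le hle] at hw hz
    unfold hAr at hw; unfold hBr at hz
    nlinarith
  · unfold Aw at hw; unfold Bz at hz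
    rw [wt_of_lt hlt] at hw hz
    have hj3 : (1 : ℝ) ≤ (j : ℝ) ^ 3 := one_le_pow₀ (by exact_mod_cast hj)
    have h1 : (1 / 800 : ℝ) / (j : ℝ) ^ 3 ≤ 1 / 800 := div_le_self (by norm_num) hj3
    have h2 : (7 / 20 : ℝ) / (j : ℝ) ^ 3 ≤ 7 / 20 := div_le_self (by norm_num) hj3
    nlinarith

/-- **Geometric bound at all orders**: `|w_j(r)| ≤ 3·10^j` and `|z_j(r)| ≤ 3·10^j` for every `j`, on the window (the form
consumed by the summation lemmas of `…SonicAnalytic`). [cite: BuckmasterCaolaboraGomezserrano2025, Prop. 2.3, App. B] -/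
theorem abs_wz_le_three_pow (hr : r ∈ Set.Icc ((13890041/12500000 : ℚ) : ℝ) ((697/625 : ℚ) : ℝ)) (j : ℕ) :
    |w r j| ≤ 3 * (10 : ℝ) ^ j ∧ |z r j| ≤ 3 * (10 : ℝ) ^ j := by
  obtain ⟨hw, hz⟩ := abs_wz_le_weight hr j
  have hp : (0 : ℝ) < (10 : ℝ) ^ j := by positivity
  rcases le_or_gt j 60 with hle | hlt
  · obtain ⟨-, h2, h3⟩ := of_headSumChkW2 61 headSumChkW2_ok j (by omega)
    have h2' := (Rat.cast_le (K := ℝ)).mpr h2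
    have h3' := (Rat.cast_le (K := ℝ)).mpr h3
    push_cast at h2' h3'
    unfold Aw at hw; unfold Bz at hz
    rw [wt_of_le hle] at hw hz
    unfold hAr at hw; unfold hBr at hz
    constructor <;> nlinarith
  · unfold Aw at hw; unfold Bz at hz
    rw [wt_of_lt hlt] at hw hz
    have hj3 : (1 : ℝ) ≤ (j : ℝ) ^ 3 := one_le_pow₀ (by exact_mod_cast (show 1 ≤ j by omega))
    have h1 : (1 / 800 : ℝ) / (j : ℝ) ^ 3 ≤ 1 / 800 := div_le_self (by norm_num) hj3
    have h2 : (7 / 20 : ℝ) / (j : ℝ) ^ 3 ≤ 7 / 20 := div_le_self (by norm_num) hj3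
    constructor <;> nlinarith

end SW2

end SonicSeries

end Monatomic

end BuckmasterCaolaboraGomezserrano2025

end Literature.Analysis.FluidPDE
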